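import Summits.CriticalPhenomena.PercolationContinuityZ3.Theorems.PercNearOneGluingNoHeavyLowerTailKnQuestion8CoefficientwiseCoreClassKernelMixParallel
import Summits.CriticalPhenomena.PercolationContinuityZ3.Theorems.PercNearOneGluingNoHeavyLowerTailKnQuestion8CoefficientwiseCoreClassKernelWrapper
import HarnessLib

/-!
# KB-MIX ∥ MAP, packaged: all levels, and CW-PA on the core class over a parallel composition

Support file (`--supports stmt-CriticalPhenomena-4575`, closed), prover `prim-cplus-coupling` (gen 35).  No definitions, no notations, no named facts,
no sorries; standard axioms.  Memo `prim-cplus-coupling/A5-COUPLING-gen35.md` §1, §4(c).  Wrappers around `…CoreClassKernelMixParallel`.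
* `Coefficientwise.cwpa_coreClass_of_kernelMixFull_allLevels` — generic: KB-MIX-FULL of `(E_H; a, b)` for all monotone test functions and levels ⟹
  CW-PA (all monotone `f, g`) on the core class `N(x) = N(z) = {a, b}` over `E_H` (equal levels + `…KernelMixFull` + `…KernelWrapper`).
* `Coefficientwise.coreClass_kernelMixFull_parallel_allLevels` — KB-MIX-FULL of `(E₁; a, b)` for all levels and a domination map of `(E₂; a, b)` ⟹
  KB-MIX-FULL of `(E₁ ∪ E₂; a, b)` for all levels (`E₁ ∥ E₂` at `{a, b}`).
* `Coefficientwise.cwpa_coreClass_of_parallel` — hence CW-PA on the core class over `E₁ ∥ E₂`; this makes the 'PAR' certificates of the gen-33 coverage census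
  (KB-MIX side from leaves / series / decorations, map side pocket-free / bundle / ADJ) Lean-explicit.
[cite: KozmaNitzan2024, Questions 8–9 (§5.5 p. 36) (context: the Question-8 pocket covariance programme)]
-/

namespace Summit.CriticalPhenomena.PercolationContinuityZ3.Theorems

open Finset Literature.Probability.Percolation

namespace Coefficientwise

variable {ι V : Type*}

open Classical in
/-- **From KB-MIX-FULL at all levels to CW-PA on the core class.**  Core-class bookkeeping for the middle graph `E_H` (terminals `a, b` joined to `x, z` by
`ixa, ixb, iza, izb`; no edge of `E_H` at `x, z`).  If KB-MIX-FULL of `(E_H; a, b)` holds for all monotone `h, k` and monotone levels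
`0 ≤ hᵃ, hᵇ ≤ h`, `0 ≤ kᵃ, kᵇ ≤ k`, then for all monotone `f, g`: `0 ≤ Σ_{s ⊆ E₀ : z ∉ C_x(s), z ∉ C_x(E₀∖s)} f(C_x s)·(g(C_x s) − g(C_x(E₀∖s)))`.
[cite: KozmaNitzan2024, Questions 8–9 (§5.5 p. 36) (context)] -/
theorem cwpa_coreClass_of_kernelMixFull_allLevels (ends : ι → Sym2 V) (EH E₀ : Finset ι) (x z a b : V) (ixa ixb iza izb : ι)
    (hxa : ends ixa = s(x, a)) (hxb : ends ixb = s(x, b)) (hza : ends iza = s(z, a)) (hzb : ends izb = s(z, b))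
    (hH : ∀ i ∈ EH, x ∉ ends i ∧ z ∉ ends i) (hE₀ : ∀ i, i ∈ E₀ ↔ i ∈ EH ∨ i = ixa ∨ i = ixb ∨ i = iza ∨ i = izb)
    (hnot : ixa ∉ EH ∧ ixb ∉ EH ∧ iza ∉ EH ∧ izb ∉ EH)
    (hd : ixa ≠ ixb ∧ ixa ≠ iza ∧ ixa ≠ izb ∧ ixb ≠ iza ∧ ixb ≠ izb ∧ iza ≠ izb)
    (hxz : x ≠ z) (hxa' : x ≠ a) (hxb' : x ≠ b) (hza' : z ≠ a) (hzb' : z ≠ b)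
    (hall : ∀ h k ha hb ka kb : Set V → ℝ, Monotone h → Monotone k → Monotone ha → Monotone hb → Monotone ka → Monotone kb →
      (∀ X, 0 ≤ ha X) → (∀ X, ha X ≤ h X) → (∀ X, 0 ≤ hb X) → (∀ X, hb X ≤ h X) →
      (∀ X, 0 ≤ ka X) → (∀ X, ka X ≤ k X) → (∀ X, 0 ≤ kb X) → (∀ X, kb X ≤ k X) →
      0 ≤ (∑ ω ∈ EH.powerset,
          h (openCluster (ends '' (↑ω : Set ι)) a ∪ openCluster (ends '' (↑ω : Set ι)) b) *
            k (openCluster (ends '' (↑ω : Set ι)) a ∪ openCluster (ends '' (↑ω : Set ι)) b))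
        + ∑ ω ∈ EH.powerset.filter (fun ω : Finset ι => b ∉ openCluster (ends '' (↑ω : Set ι)) a ∧ b ∉ openCluster (ends '' (↑(EH \ ω) : Set ι)) a),
          (ha (openCluster (ends '' (↑ω : Set ι)) a) - hb (openCluster (ends '' (↑(EH \ ω) : Set ι)) b)) *
            (ka (openCluster (ends '' (↑ω : Set ι)) a) - kb (openCluster (ends '' (↑(EH \ ω) : Set ι)) b)))
    (f g : Set V → ℝ) (hf : Monotone f) (hg : Monotone g) :
    0 ≤ ∑ s ∈ E₀.powerset.filter (fun s : Finset ι => z ∉ openCluster (ends '' (↑s : Set ι)) x ∧ z ∉ openCluster (ends '' (↑(E₀ \ s) : Set ι)) x),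
      f (openCluster (ends '' (↑s : Set ι)) x) * (g (openCluster (ends '' (↑s : Set ι)) x) - g (openCluster (ends '' (↑(E₀ \ s) : Set ι)) x)) := by
  refine cwpa_coreClass_of_kernel ends EH E₀ x z a b ixa ixb iza izb hxa hxb hza hzb hH hE₀ hnot hd hxz hxa' hxb' hza' hzb' ?_ f g hf hg
  intro f' g' hf' hf0' hg'
  have hf_nonneg : ∀ X : Set V, 0 ≤ f' X := fun X => by rw [← hf0']; exact hf' (Set.empty_subset X)
  have hg'' : Monotone (fun X : Set V => g' X - g' ∅) := fun X Y hXY => sub_le_sub_right (hg' hXY) _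
  have hg0 : ∀ X : Set V, 0 ≤ g' X - g' ∅ := fun X => sub_nonneg.mpr (hg' (Set.empty_subset X))
  refine coreClass_kernel_nonneg_of_kernelMixFull ends EH a b f' g' ?_
  exact hall f' (fun X : Set V => g' X - g' ∅) f' f' (fun X : Set V => g' X - g' ∅) (fun X : Set V => g' X - g' ∅) hf' hg'' hf' hf' hg'' hg''
    hf_nonneg (fun X => le_refl _) hf_nonneg (fun X => le_refl _) hg0 (fun X => le_refl _) hg0 (fun X => le_refl _)

open Classical in
/-- **KB-MIX ∥ MAP, all levels.**  `E₁, E₂` disjoint with edges sharing no vertex other than `a, b`; KB-MIX-FULL of `(E₁; a, b)` for all levels; a domination map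
`ψ₂` of `(E₂; a, b)` (injective on the wall event, `ψ₂ ω ⊆ E₂`, `C_a ω ∪ C_b(E₂∖ω) ⊆ C_a(ψ₂ω) ∪ C_b(ψ₂ω)` there).  Then KB-MIX-FULL of `(E₁ ∪ E₂; a, b)`
holds for all monotone `h, k` and monotone levels `0 ≤ hᵃ, hᵇ ≤ h`, `0 ≤ kᵃ, kᵇ ≤ k`. [cite: KozmaNitzan2024, Questions 8–9 (§5.5 p. 36) (context)] -/
theorem coreClass_kernelMixFull_parallel_allLevels (ends : ι → Sym2 V) (E₁ E₂ : Finset ι) (a b : V) (hdisj : Disjoint E₁ E₂)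
    (hsep : ∀ i ∈ E₁, ∀ j ∈ E₂, ∀ v, v ∈ ends i → v ∈ ends j → v = a ∨ v = b)
    (hall : ∀ h k ha hb ka kb : Set V → ℝ, Monotone h → Monotone k → Monotone ha → Monotone hb → Monotone ka → Monotone kb →
      (∀ X, 0 ≤ ha X) → (∀ X, ha X ≤ h X) → (∀ X, 0 ≤ hb X) → (∀ X, hb X ≤ h X) →
      (∀ X, 0 ≤ ka X) → (∀ X, ka X ≤ k X) → (∀ X, 0 ≤ kb X) → (∀ X, kb X ≤ k X) →
      0 ≤ (∑ ω ∈ E₁.powerset,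
          h (openCluster (ends '' (↑ω : Set ι)) a ∪ openCluster (ends '' (↑ω : Set ι)) b) *
            k (openCluster (ends '' (↑ω : Set ι)) a ∪ openCluster (ends '' (↑ω : Set ι)) b))
        + ∑ ω ∈ E₁.powerset.filter (fun ω : Finset ι => b ∉ openCluster (ends '' (↑ω : Set ι)) a ∧ b ∉ openCluster (ends '' (↑(E₁ \ ω) : Set ι)) a),
          (ha (openCluster (ends '' (↑ω : Set ι)) a) - hb (openCluster (ends '' (↑(E₁ \ ω) : Set ι)) b)) *
            (ka (openCluster (ends '' (↑ω : Set ι)) a) - kb (openCluster (ends '' (↑(E₁ \ ω) : Set ι)) b)))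
    (ψ₂ : Finset ι → Finset ι)
    (hψE : ∀ ω, ω ⊆ E₂ → b ∉ openCluster (ends '' (↑ω : Set ι)) a → b ∉ openCluster (ends '' (↑(E₂ \ ω) : Set ι)) a → ψ₂ ω ⊆ E₂)
    (hψcov : ∀ ω, ω ⊆ E₂ → b ∉ openCluster (ends '' (↑ω : Set ι)) a → b ∉ openCluster (ends '' (↑(E₂ \ ω) : Set ι)) a →
      openCluster (ends '' (↑ω : Set ι)) a ∪ openCluster (ends '' (↑(E₂ \ ω) : Set ι)) b ⊆
        openCluster (ends '' (↑(ψ₂ ω) : Set ι)) a ∪ openCluster (ends '' (↑(ψ₂ ω) : Set ι)) b)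
    (hψinj : ∀ ω₁ ω₂, ω₁ ⊆ E₂ → b ∉ openCluster (ends '' (↑ω₁ : Set ι)) a → b ∉ openCluster (ends '' (↑(E₂ \ ω₁) : Set ι)) a →
      ω₂ ⊆ E₂ → b ∉ openCluster (ends '' (↑ω₂ : Set ι)) a → b ∉ openCluster (ends '' (↑(E₂ \ ω₂) : Set ι)) a → ψ₂ ω₁ = ψ₂ ω₂ → ω₁ = ω₂)
    (h k ha hb ka kb : Set V → ℝ) (hh : Monotone h) (hk : Monotone k)
    (mha : Monotone ha) (mhb : Monotone hb) (mka : Monotone ka) (mkb : Monotone kb)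
    (ha0 : ∀ X, 0 ≤ ha X) (hah : ∀ X, ha X ≤ h X) (hb0 : ∀ X, 0 ≤ hb X) (hbh : ∀ X, hb X ≤ h X)
    (ka0 : ∀ X, 0 ≤ ka X) (kak : ∀ X, ka X ≤ k X) (kb0 : ∀ X, 0 ≤ kb X) (kbk : ∀ X, kb X ≤ k X) :
    0 ≤ (∑ ω ∈ (E₁ ∪ E₂).powerset,
        h (openCluster (ends '' (↑ω : Set ι)) a ∪ openCluster (ends '' (↑ω : Set ι)) b) *
          k (openCluster (ends '' (↑ω : Set ι)) a ∪ openCluster (ends '' (↑ω : Set ι)) b))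
      + ∑ ω ∈ (E₁ ∪ E₂).powerset.filter (fun ω : Finset ι => b ∉ openCluster (ends '' (↑ω : Set ι)) a ∧
            b ∉ openCluster (ends '' (↑((E₁ ∪ E₂) \ ω) : Set ι)) a),
        (ha (openCluster (ends '' (↑ω : Set ι)) a) - hb (openCluster (ends '' (↑((E₁ ∪ E₂) \ ω) : Set ι)) b)) *
          (ka (openCluster (ends '' (↑ω : Set ι)) a) - kb (openCluster (ends '' (↑((E₁ ∪ E₂) \ ω) : Set ι)) b)) := by
  have ha_nn : ∀ X, 0 ≤ h X := fun X => le_trans (ha0 X) (hah X)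
  have ka_nn : ∀ X, 0 ≤ k X := fun X => le_trans (ka0 X) (kak X)
  refine coreClass_kernelMixFull_parallel ends E₁ E₂ a b hdisj hsep h k ha hb ka kb hh hk ha_nn ka_nn ψ₂ hψE hψinj ?_
  intro ω₂ hω₂ hR hB
  set S₂ : Set V := openCluster (ends '' (↑(ψ₂ ω₂) : Set ι)) a ∪ openCluster (ends '' (↑(ψ₂ ω₂) : Set ι)) b with hS₂
  set P₂ : Set V := openCluster (ends '' (↑ω₂ : Set ι)) a with hP₂
  set Q₂ : Set V := openCluster (ends '' (↑(E₂ \ ω₂) : Set ι)) b with hQ₂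
  have hcov := hψcov ω₂ hω₂ hR hB
  have hPS : P₂ ⊆ S₂ := fun y hy => hcov (Or.inl hy)
  have hQS : Q₂ ⊆ S₂ := fun y hy => hcov (Or.inr hy)
  have um : ∀ (Z : Set V), Monotone (fun X : Set V => X ∪ Z) := fun Z X Y hXY => Set.union_subset_union_left Z hXY
  exact hall (fun X => h (X ∪ S₂)) (fun X => k (X ∪ S₂)) (fun X => ha (X ∪ P₂)) (fun X => hb (X ∪ Q₂)) (fun X => ka (X ∪ P₂)) (fun X => kb (X ∪ Q₂))
    (fun X Y hXY => hh (um _ hXY)) (fun X Y hXY => hk (um _ hXY))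
    (fun X Y hXY => mha (um _ hXY)) (fun X Y hXY => mhb (um _ hXY)) (fun X Y hXY => mka (um _ hXY)) (fun X Y hXY => mkb (um _ hXY))
    (fun X => ha0 _) (fun X => le_trans (hah _) (hh (Set.union_subset_union_right X hPS)))
    (fun X => hb0 _) (fun X => le_trans (hbh _) (hh (Set.union_subset_union_right X hQS)))
    (fun X => ka0 _) (fun X => le_trans (kak _) (hk (Set.union_subset_union_right X hPS)))
    (fun X => kb0 _) (fun X => le_trans (kbk _) (hk (Set.union_subset_union_right X hQS)))

open Classical in
/-- **CW-PA on the core class over a parallel composition `E₁ ∥ E₂`** (KB-MIX-FULL of `E₁` at all levels, a domination map `ψ₂` of `E₂`): core-class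
bookkeeping for `E_H = E₁ ∪ E₂` as in `cwpa_coreClass_of_kernelMixFull_allLevels`; conclusion `0 ≤ Σ_{s ⊆ E₀ : z ∉ C_x(s), z ∉ C_x(E₀∖s)} f(C_x s)(g(C_x s) − g(C_x(E₀∖s)))`
for all monotone `f, g`. [cite: KozmaNitzan2024, Questions 8–9 (§5.5 p. 36) (context)] -/
theorem cwpa_coreClass_of_parallel (ends : ι → Sym2 V) (E₁ E₂ E₀ : Finset ι) (x z a b : V) (ixa ixb iza izb : ι) (hdisj : Disjoint E₁ E₂)
    (hsep : ∀ i ∈ E₁, ∀ j ∈ E₂, ∀ v, v ∈ ends i → v ∈ ends j → v = a ∨ v = b)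
    (hall : ∀ h k ha hb ka kb : Set V → ℝ, Monotone h → Monotone k → Monotone ha → Monotone hb → Monotone ka → Monotone kb →
      (∀ X, 0 ≤ ha X) → (∀ X, ha X ≤ h X) → (∀ X, 0 ≤ hb X) → (∀ X, hb X ≤ h X) →
      (∀ X, 0 ≤ ka X) → (∀ X, ka X ≤ k X) → (∀ X, 0 ≤ kb X) → (∀ X, kb X ≤ k X) →
      0 ≤ (∑ ω ∈ E₁.powerset,
          h (openCluster (ends '' (↑ω : Set ι)) a ∪ openCluster (ends '' (↑ω : Set ι)) b) *
            k (openCluster (ends '' (↑ω : Set ι)) a ∪ openCluster (ends '' (↑ω : Set ι)) b))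
        + ∑ ω ∈ E₁.powerset.filter (fun ω : Finset ι => b ∉ openCluster (ends '' (↑ω : Set ι)) a ∧ b ∉ openCluster (ends '' (↑(E₁ \ ω) : Set ι)) a),
          (ha (openCluster (ends '' (↑ω : Set ι)) a) - hb (openCluster (ends '' (↑(E₁ \ ω) : Set ι)) b)) *
            (ka (openCluster (ends '' (↑ω : Set ι)) a) - kb (openCluster (ends '' (↑(E₁ \ ω) : Set ι)) b)))
    (ψ₂ : Finset ι → Finset ι)
    (hψE : ∀ ω, ω ⊆ E₂ → b ∉ openCluster (ends '' (↑ω : Set ι)) a → b ∉ openCluster (ends '' (↑(E₂ \ ω) : Set ι)) a → ψ₂ ω ⊆ E₂)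
    (hψcov : ∀ ω, ω ⊆ E₂ → b ∉ openCluster (ends '' (↑ω : Set ι)) a → b ∉ openCluster (ends '' (↑(E₂ \ ω) : Set ι)) a →
      openCluster (ends '' (↑ω : Set ι)) a ∪ openCluster (ends '' (↑(E₂ \ ω) : Set ι)) b ⊆
        openCluster (ends '' (↑(ψ₂ ω) : Set ι)) a ∪ openCluster (ends '' (↑(ψ₂ ω) : Set ι)) b)
    (hψinj : ∀ ω₁ ω₂, ω₁ ⊆ E₂ → b ∉ openCluster (ends '' (↑ω₁ : Set ι)) a → b ∉ openCluster (ends '' (↑(E₂ \ ω₁) : Set ι)) a →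
      ω₂ ⊆ E₂ → b ∉ openCluster (ends '' (↑ω₂ : Set ι)) a → b ∉ openCluster (ends '' (↑(E₂ \ ω₂) : Set ι)) a → ψ₂ ω₁ = ψ₂ ω₂ → ω₁ = ω₂)
    (hxa : ends ixa = s(x, a)) (hxb : ends ixb = s(x, b)) (hza : ends iza = s(z, a)) (hzb : ends izb = s(z, b))
    (hH : ∀ i ∈ E₁ ∪ E₂, x ∉ ends i ∧ z ∉ ends i) (hE₀ : ∀ i, i ∈ E₀ ↔ i ∈ E₁ ∪ E₂ ∨ i = ixa ∨ i = ixb ∨ i = iza ∨ i = izb)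
    (hnot : ixa ∉ E₁ ∪ E₂ ∧ ixb ∉ E₁ ∪ E₂ ∧ iza ∉ E₁ ∪ E₂ ∧ izb ∉ E₁ ∪ E₂)
    (hd : ixa ≠ ixb ∧ ixa ≠ iza ∧ ixa ≠ izb ∧ ixb ≠ iza ∧ ixb ≠ izb ∧ iza ≠ izb)
    (hxz : x ≠ z) (hxa' : x ≠ a) (hxb' : x ≠ b) (hza' : z ≠ a) (hzb' : z ≠ b)
    (f g : Set V → ℝ) (hf : Monotone f) (hg : Monotone g) :
    0 ≤ ∑ s ∈ E₀.powerset.filter (fun s : Finset ι => z ∉ openCluster (ends '' (↑s : Set ι)) x ∧ z ∉ openCluster (ends '' (↑(E₀ \ s) : Set ι)) x),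
      f (openCluster (ends '' (↑s : Set ι)) x) * (g (openCluster (ends '' (↑s : Set ι)) x) - g (openCluster (ends '' (↑(E₀ \ s) : Set ι)) x)) :=
  cwpa_coreClass_of_kernelMixFull_allLevels ends (E₁ ∪ E₂) E₀ x z a b ixa ixb iza izb hxa hxb hza hzb hH hE₀ hnot hd hxz hxa' hxb' hza' hzb'
    (fun h k ha hb ka kb hh hk mha mhb mka mkb ha0 hah hb0 hbh ka0 kak kb0 kbk =>
      coreClass_kernelMixFull_parallel_allLevels ends E₁ E₂ a b hdisj hsep hall ψ₂ hψE hψcov hψinj h k ha hb ka kb hh hk mha mhb mka mkb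
        ha0 hah hb0 hbh ka0 kak kb0 kbk) f g hf hg

end Coefficientwise

end Summit.CriticalPhenomena.PercolationContinuityZ3.Theorems
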